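import Mathlib
import HarnessLib
import HarnessLib.Audit
import Summits.KontsevichZagierPeriods.Statement
import HarnessLib.Audit.Status.Attr

/-!
Route: InequalityCost

DORMANT since 2026-08-24T14:38:35Z (reconciler: no traction for 6.8 d (last activity item-evidence-added at 2026-08-17T18:08:33Z); parked, not closed — `ledger route dormant route-KontsevichZagierPeriods-InequalityCost --off` to reactiv) — unstaffed, not closed; items shared with open routes are served there. `ledger route dormant <id> --off` reactivates.

# Route InequalityCost — equality is bounded-cost inequality — tame ε-certificates glue and close
into a chain

It suffices to show X := TameVolumeKernel — Conjecture 1 for TAME VOLUME FORMS: two ℚ-semialgebraic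
representations of the same
dimension with bounded domains and integrand 1 of equal volume are KZ-equivalent — together with the
bridge TameFormsSuffice
(X → summit: Viu-Sos' semi-canonical reduction run inside the rules). The route realises idea card
equality-is-bounded-cost-inequality:
X is attacked by THE SQUEEZE (TameSqueeze, provable glue): if the ε-inequality certificates of |vol
A − vol B| ≤ ε inside the tame rules
have BOUNDED description size as ε → 0⁺ over the rationals (BoundedCost, the card's "inequality
proofs never get harder"), then the level
set is first-order hence cofinite, definable choice glues the certificates into ONE ℚ-semialgebraic
tame family of chains over (0,δ), and
the per-move tame closure lemmas (TameCovLimit, TameNLLimit, AddLimits) pass to the L¹-limit t → 0⁺,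
which is an honest chain A ~ B.
So X ⇐ closure lemmas ∧ BoundedCost, and the summit ⇐ X ∧ TameFormsSuffice.
Lean: `∀ ⦃n : ℕ⦄ (N : ℕ) (A B : Literature.NumberTheory.Transcendental.KZ.IntegralRep n), (∀ x ∈
A.domain, ∀ i, |x i| ≤ N) → Set.EqOn A.integrand 1 A.domain → (∀ x ∈ B.domain, ∀ i, |x i| ≤ N) →
Set.EqOn B.integrand 1 B.domain → A.value = B.value →
Literature.NumberTheory.Transcendental.KZ.Equivalent A B`

## Assembly
Pure logic (`example : Assembly := fun hS hA hC hN hB hT => hT (hS hA hC hN hB)` in Sketch.lean,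
lean check rc 0): TameSqueeze turns
the three closure lemmas and BoundedCost into TameVolumeKernel, and TameFormsSuffice carries
TameVolumeKernel to
KontsevichZagierPeriods = Literature.Periods.KZPeriodConjecture. Logical status: Summit ⇒
TameVolumeKernel (trivial, checked) and Summit ⇏
BoundedCost without tame conservativity (flagged); AddLimits, TameLimitExists, DefinableChoice,
FinitePacking, TameSqueeze are provable now.

Rationale: WHY THIS LINE. Viu-Sos' packing (Viusos2020 = arXiv:1509.01097, §4 Lemmas 4.1–4.3, Rem. 4.1) proves
every STRICT inequality between volumes of compact
semialgebraic sets inside the KZ-rules by a chain of bounded LENGTH whose description complexity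
grows with the mesh; this route makes the
growth of that complexity in ε the invariant: modulo the provable squeeze, A ~ B ⟺ the one-sided
certificates [A]+[C_ε]−[B] ~ [P_ε ≥ 0]
have bounded size, because a bounded-size certificate predicate with real parameters is a
first-order condition on ε (tame data are
automatically absolutely integrable, so no IntegrabilityLocus fact is needed, unlike route
DefinableMoves), its level set contains ℚ∩(0,1)
hence an interval, definable choice (Dries1998 Ch. 6 (1.2)) gives a uniform template family, and
o-minimal standard parts of TAME
(uniformly bounded) move families are again moves (the tight case S1 of route StandardParts, here
typed per move kind over raw
semialgebraic total families). Imported: real algebraic / o-minimal geometry (Tarski1951, Dries1998,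
doi:10.1007/s00029-004-0360-z,
CluckersMiller2011) pointed at the PROOF relation, and proof-complexity thinking (cost of
certificates) pointed at inequalities rather
than equalities (route DimensionBudget budgets equality chains only). What no prior route does:
StandardParts' SpArcClosure is typed over
`ℝ → KZ.IntegralRep n`, which forces every real fibre to be ℚ-semialgebraic and hence (∅-definable
coincidence sets) the arc to be
EVENTUALLY CONSTANT near 0 — its closure statement degenerates to a.e.-congruence and SpArcLifting
to the summit; here families are raw
ℚ-semialgebraic total sets/functions whose real fibres are mere sets, only limits are
representations, and the arcs are MANUFACTURED from
inequality certificates instead of being assumed from identity engines. Negatives index: empty at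
filing (0 refuted statements). (Rev 3, cone repair 2026-08-15: the certificate calculus of
BoundedCost measures description complexity by Basu–Pollack–Roy data —
number and degree of real polynomials — instead of Gödel codes of ordered-ring formulas, so the
route file imports nothing beyond the Statement: the
DecidableTheory import, whose cone carried the two undischarged facts
FirstOrder.Language.Theory.IsComputablyAxiomatizable.isRE /
isDecidable_of_isComplete_of_isComputablyAxiomatizable that no item used, is gone; needs-fact:
none.)

RANKED CRUXES. #0 TameVolumeKernel (target) — X — Conjecture 1 for tame volume forms of equal
dimension: A, B : KZ.IntegralRep n with domains in the box [−N,N]ⁿ, integrand 1 on the domain and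
A.value = B.value are KZ.Equivalent. Summit-implied (volume forms are KZ-rational with p = q = 1;
`example` in Sketch.lean); the squeeze proves it from the closure lemmas and BoundedCost
(TameSqueeze). (why it might fail: Conjecture strength: it is the summit restricted to compact
volume forms (Cresson–Viu-Sos' setting), so every strength barrier applies; route Neg's suspicious
pairs (triplication 0312, octic regulators) become pairs of this shape after reduction.)
[KontsevichZagier2001, Viusos2020, CressonViusos2022]
#2 TameCovLimit (crux) — TAME CLOSURE FOR RULE 2 (card K1, per move kind). Let S, S' ⊆ ℝⁿ⁺¹ be
ℚ-semialgebraic total spaces (parameter t = last coordinate) with ℚ-semialgebraic integrands G on S,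
G' on S' and a ℚ-semialgebraic map Φ : S → ℝⁿ, all TAME (S, S' ⊆ [−N,N]ⁿ⁺¹, |G|,|G'| ≤ N). Suppose
for every t ∈ (0,1) the fibre data form a change-of-variables instance: φ_t = Φ(·,t) is injective on
S_t, φ_t(S_t) = S'_t, and at every x ∈ S_t some L with HasFDerivWithinAt φ_t L S_t x and G_t x =
G'_t(φ_t x)·|det L|. If (S_t,G_t) → r₀ and (S'_t,G'_t) → r₀' in L¹ as t → 0⁺ (r₀, r₀' :
KZ.IntegralRep n), then KZ.Equivalent r₀ r₀'. The Jacobian is NOT assumed bounded: degeneration of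
φ_t in the limit is the content. [difficulty: L] (why it might fail: Tameness bounds G, G' but not
det ∂φ_t: φ_t may collapse or fold as t→0⁺, so φ_0 is no CoV instance; the proof needs (a) ∂φ_t →
∂φ_0 a.e. for tame definable families (unprinted in this form) and (b) the mass through the
degenerating set to be L¹-negligible on BOTH sides.) [KontsevichZagier2001, Dries1998,
doi:10.1007/s00029-004-0360-z, CluckersMiller2011, ComteLionRolin2000]
#3 BoundedCost (crux) — BOUNDED COST (card K1/K4 hypothesis, the thesis proper): for tame volume
forms A, B of equal volume there is N such that for EVERY rational ε ∈ (0,1) a one-sided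
ε-certificate of size ≤ N exists: a formal identity [A]−[B]+[C_ε]−[p] = Σ_(i<N) m_i in the free
abelian group on raw pairs (σ ⊆ ℝᵏ, f), where C_ε = ([0,ε] ⊆ ℝ¹, 1), p has integrand ≥ 0, and each
m_i is ± an instance of one of the four KZ moves rewritten over REAL-semialgebraic data all of which
are N-TAME (k ≤ N, domains in [−N,N]ᵏ, |integrands| ≤ N, zero off the domain, |F| ≤ N for
primitives) and of DESCRIPTION COMPLEXITY ≤ N in the Basu–Pollack–Roy format (each set / graph is a
union of ≤ N basic semialgebraic pieces {P_i1 = … = P_iN = 0, Q_i1 > 0, …, Q_iN > 0} cut out by REAL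
polynomials of total degree ≤ N — Mathlib `MvPolynomial` only; rev 3 cone repair, equivalent to rev
1's 'ordered-ring formula of code ≤ N with ≤ N real parameters' up to N ↦ g(N) by quantifier
elimination, BasuPollackRoy2006 §2.3 + Thm 2.77, so the ∃N-statement is unchanged; the real
coefficients are the parameters θ, ε may be one of them). Soundly, such a certificate proves vol A −
vol B ≥ −ε. "Inequality proofs never get harder": N_c(ε) = O(1). The `let`-prefix IS the posited
tame certificate calculus written inline (definition request D2 supersedes it). [difficulty:
open-problem] (why it might fail: Summit-strength and a little more: modulo TameSqueeze it IS
Conjecture 1 for (A,B), and even when A ~ B the known chain may need untame or ε-dependent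
high-complexity detours (no tame conservativity theorem); for Neg's pair 0312 cost growth N_c(ε) → ∞
is precisely a disproof of Conjecture 1.) [Viusos2020, arXiv:1509.01097, KontsevichZagier2001,
BasuPollackRoy2006, CressonViusos2022]
#4 TameNLLimit (crux) — TAME CLOSURE FOR RULE 3. Let B ⊆ ℝⁿ⁺² (band points (x,s,t), t = last
coordinate the parameter, s the integration variable) and T ⊆ ℝⁿ⁺¹ (base points (x,t)) be
ℚ-semialgebraic, with ℚ-semialgebraic G, F on B and H, a, b on T, all tame (boxes [−N,N],
|G|,|F|,|H| ≤ N). Suppose for every t ∈ (0,1): a_t ≤ b_t on T_t, B_t is the band {(x,s) : x ∈ T_t,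
a_t x ≤ s ≤ b_t x}, s ↦ F_t(x,s) is continuous on [a_t x, b_t x] with derivative G_t(x,s) on the
open fibre, and H_t x = F_t(x,b_t x) − F_t(x,a_t x). If (B_t,G_t) → r₀ (dimension n+1) and (T_t,H_t)
→ r₀' (dimension n) in L¹ as t → 0⁺ then KZ.Equivalent r₀ r₀'. [difficulty: L] (why it might fail:
G_0(x,·) is only piecewise continuous and a_0 = b_0 may hold on fat parts of T_0, so rule 3 fails
for the raw limit band: it must be re-split along the semialgebraic discontinuity locus and null
bands discarded; F_t → F_0 needs |F| ≤ N (renormalised primitives).) [KontsevichZagier2001,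
Dries1998, ComteLionRolin2000, BochnakCosteRoy1998]
#5 TameFormsSuffice (crux) — TAME VOLUME FORMS SUFFICE: TameVolumeKernel → KontsevichZagierPeriods.
Plan (Viusos2020 Thm 1.1 / Cor. 2.3 "respecting the KZ-rules"): every KZ-rational representation is
KZ-equivalent to [K₁] − [K₂] with K₁, K₂ compact top-dimensional ℚ-semialgebraic sets carrying
integrand 1 — compactify the domain by the projective cube charts (tree: PeriodCompactDomain, CoV
moves), separate the boundary poles by embedded resolution of ∂S ∪ {PQ = 0} (blow-ups are CoV moves
off exceptional divisors; Hironaka1964, BelkaleBrosnan2003), pass to volume form by the graph trick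
(tree: KZ.IntegralRep.graphRep, one Newton–Leibniz move), pad dimensions (tree:
exists_equivalent_of_le) and glue disjoint translates (tree: IntegralRep.glue); then r ~ [A]−[B], r'
~ [A']−[B'] with vol(A ⊔ B') = vol(B ⊔ A') and TameVolumeKernel closes the chain. [difficulty: XL]
(why it might fail: Viu-Sos asserts "respects the KZ-rules" only informally (Rem. 4.1, §2.3):
resolution must keep every intermediate piece absolutely convergent and ℚ-semialgebraic, and blow-up
charts are CoV instances only off exceptional divisors; Hironaka in Lean is XL.) [Viusos2020,
Hironaka1964, BelkaleBrosnan2003, Yoshinaga2008, KontsevichZagier2001]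
#9 AddLimits (support) — TAME CLOSURE FOR RULE 1 (both halves): L¹-limits at 0⁺ of tame
ℚ-semialgebraic families of domain-additivity instances (S_t = S₁_t ∪ S₂_t with null overlap,
integrands agreeing) resp. integrand-additivity instances (G = G₁ + G₂ on S) satisfy [r] − [r₁] −
[r₂] ∈ KZ.relations. Proof: the a.e. identity 1_r f = 1_(r₁) f₁ + 1_(r₂) f₂ passes to L¹-limits;
split ℝⁿ along the ℚ-semialgebraic Boolean atoms of the three domains and of {f = f₁ + f₂}, {f =
f₁}, {f = f₂} (Tarski–Seidenberg, tree tarski_seidenberg_real_holds), use integrand additivity on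
fat overlaps and domain additivity elsewhere, and kill null discrepancies as in StandardParts'
SpAeCongruence (stmt-3156). [difficulty: provable-now] [KontsevichZagier2001, BochnakCosteRoy1998]
#9 TameLimitExists (support) — every tame ℚ-semialgebraic family (S ⊆ [−N,N]ⁿ⁺¹, |G| ≤ N on S) has
an L¹-limit representation r₀ : KZ.IntegralRep n as t → 0⁺: pointwise limits of t ↦ 1_(S_t)(x)
G(x,t) exist by o-minimal monotonicity (tree: real_isOMinimal_holds,
OMinimalLimits.tendsto_nhdsGT_or), the limit set/function are ∅-definable hence ℚ-semialgebraic
(definable_iff_isSemialgebraic_real_holds), bounded, and dominated convergence gives L¹-convergence.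
Supplies the limit objects of every intermediate family in TameSqueeze. [difficulty: provable-now]
[Dries1998, doi:10.1007/s00029-004-0360-z, LionRolin1998, Tarski1951]
#9 DefinableChoice (support) — DEFINABLE CHOICE over ℚ (semialgebraic selection): a ℚ-semialgebraic
V ⊆ ℝᵖ⁺ᵠ admits a ℚ-semialgebraic section g over its projection (Dries1998 Ch. 6 (1.2), p. 94: e(X)
built from least elements, ±1 and midpoints, hence ∅-definable; with
definable_iff_isSemialgebraic_real_holds). Shared need of StandardParts (SpDefinableChoice) and
DefinableMoves (AlgebraicPoints is its p = 0 shadow). [difficulty: provable-now] [Dries1998,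
BochnakCosteRoy1998, BasuPollackRoy2006]
#9 FinitePacking (support) — FINITE COST AT EVERY LEVEL (card K3 qualitative; Viu-Sos §4 inside the
TAME rules): for tame volume forms A, B ⊆ ℝⁿ⁺¹ of equal volume and every rational ε > 0 there are M,
the box K = [0,ε]×[0,1]ⁿ with integrand 1 and a tame P with 0 ≤ integrand ≤ M such that [A] + [K] −
[B] − [P] lies in the subgroup generated by move instances all of whose representations are M-tame
(dimension ≤ M, domain in [−M,M], |integrand| ≤ M on the domain) — the DimensionBudget-style
intersection of the move sets with the tame sub-free-group. Proof: glue translates (CoV by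
translation), dyadic mesh with innerCount(A ⊔ K) ≥ outerCount(B) for fine mesh (tree:
SemialgVolume.lo_le / le_hi / exists_hi_sub_lo_le, volume_frontier_eq_zero; Viusos2020 Lemmas
4.1–4.3 need vol(A ⊔ K) > vol B, true as ε > 0), one piecewise-translation CoV on the open cubes,
domain additivity, null wire-net killed by [N]−[N]−[N] ∈ domainAddRel. Certifies N_c(ε) < ∞ and
validates the certificate format of BoundedCost. [difficulty: L] [Viusos2020, arXiv:1509.01097,
Yoshinaga2008, KontsevichZagier2001]
#9 TameSqueeze (support) — THE SQUEEZE (card K1 + K2 + P2, the glue; provable now modulo its four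
hypotheses): AddLimits → TameCovLimit → TameNLLimit → BoundedCost → TameVolumeKernel. Proof: (i)
FirstOrderLevels — for fixed A, B, N the set L_N = {ε ∈ (0,1) | a size-N certificate exists} is a
finite union over the finitely many discrete templates (dimensions ≤ N, move kinds, signs,
generator-coincidence pattern; the polynomial coefficients of the Basu–Pollack–Roy descriptions are
the real parameters) of projections of ∅-definable sets: every side condition is first-order for
definable data (set identities, EqOn, InjOn, image, ε-δ HasFDerivWithinAt with an existential
matrix, ContinuousOn, HasDerivAt, a ≤ b; volume-zero ⟺ empty interior, DefinableMoves
NullIffEmptyInterior; integrability is absent because tame data are bounded Borel on bounded sets),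
so L_N is ℚ-semialgebraic (tarski_seidenberg_real_holds, definable_iff_isSemialgebraic_real_holds);
(ii) L_N ⊇ ℚ∩(0,1) ⇒ cofinite ⇒ ⊇ (0,δ), and by o-minimality ONE template covers some (0,δ'), δ' ∈
ℚ; (iii) DefinableChoice gives ∅-definable parameters θ(t), t ∈ (0,δ'), i.e. ℚ-semialgebraic tame
total families for every datum; rescale t ↦ δ't; (iv) TameLimitExists gives limit representations of
all intermediate families, the coincidence pattern of families is eventually constant, so the
free-group identity holds among family symbols and specialises to the limits; each limit move
instance is a relation by AddLimits / TameCovLimit / TameNLLimit; the constant families A, B are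
their own limits (indicator-normalised integrands), the cube family [0,t] and p_t (∫p_t = t by
soundness of the tame raw moves, p_t ≥ 0) tend to null representations, which are relations (tree:
KZ.of_empty_mem_relations); hence [A] − [B] ∈ KZ.relations. [difficulty: L] [Tarski1951, Dries1998,
BasuPollackRoy2006, Viusos2020, KontsevichZagier2001]

TWO-LAYER PLAN. Foreseen glued splits (nothing filed now; k ≤ 3, depth 1): TameCovLimit ⇐
TameC1Limit (for a tame ℚ-semialgebraic family φ_t → φ_0
the derivatives converge a.e.: uniform finiteness of monotonicity intervals bounds total variation)
→ NullCollapse (mass transported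
through {det ∂φ_t → 0 or ∞} is L¹-negligible on both sides under |G|,|G'| ≤ N) → TameCovLimit.
TameSqueeze ⇐ UniformFromBounded
(BoundedCost ⇒ one ℚ-semialgebraic tame template family on (0,δ): first-order levels +
DefinableChoice) → UniformClosure (uniform tame
template family with L¹-endpoints (A,B) ⇒ A ~ B: TameLimitExists + per-move lemmas + symbol
bookkeeping) → TameSqueeze, both statable
once definition D1 (KZ.TameMoveFamily) lands. TameFormsSuffice ⇐ CompactDomainInRules
(PeriodCompactDomain's chart identity as a
KZ-equivalence, provable now) → SeparationOfPolesInRules (Viusos2020 Prop. 2.2 / Cor. 2.2 as a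
KZ-equivalence) → TameFormsSuffice.
BoundedCost itself is never split: it is the dial the route reads (Neg: its negation for one pair).

KILL CRITERIA. (i) TameCovLimit refuted by a tame family whose limit pair is provably inequivalent
would refute the SUMMIT (limits have equal value; any
inequivalence proof is a new invariant) — close refuted:TameCovLimit, hand the witness to route Neg.
A refutation that only exhibits a
limit outside rule 2 (fold/collapse) while r₀ ~ r₀' stays open is not a kill: restate with two-sided
Jacobian bounds |det L| ∈ [1/N, N]
added to tameness (the squeeze survives: the bound is first-order). (ii) BoundedCost refuted for a
pair with A ~ B KNOWN (e.g. disc vs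
4/(1+x²)-region, both area π) ⇒ tame conservativity fails; restate BoundedCost over
uniformly-integrable (restriction-of-endpoint) pieces or
close refuted:BoundedCost if the witness shows certificates must leave every tame class. BoundedCost
refuted for a suspicious pair (Neg 0312)
with TameSqueeze + closure lemmas proved ⇒ nothing closes: that is the most valuable outcome short
of the summit (cost growth certified).
(iii) TameFormsSuffice shown to need a non-KZ move (resolution not realisable inside rules) ⇒ pivot:
the route's target becomes
TameVolumeKernel (Conjecture 1 for volumes, CressonViusos2022's setting) and the summit link is
handed to a resolution route. (iv)
Superseded if StandardParts proves a uniform-template closure covering tame templates AND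
DefinableMoves proves Transfer: TameSqueeze is
then their corollary — close superseded --by the later of the two.

NOT DECOMPOSED YET. Tame conservativity (A ~ B ⇒ a tame bounded-complexity chain exists: would make
BoundedCost exactly summit-equivalent); the Neg-facing
statement ¬BoundedCost(A₀,B₀) for the triplication pair 0312 and the cost-growth upper bound N_c(ε)
= O(ε^(−d)) (Viu-Sos packing costed) —
both wait for definition D2 so they are one-liners; two-sided certificates; FirstOrderLevels and
tame ℝ→ℚ transfer as separate items
(inside TameSqueeze's proof; DefinableMoves CovTransfer is the model); the experimental cost curves
(card K4: N_c(2^(−k)) for ζ(2)-pairs,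
0312, octic pair by bounded search) — a kit job for a tenure/mechanism seat; multi-parameter arcs;
any engine for BoundedCost
(self-similar packings along ε₀λᵏ, card remark) — positive engines are a different route.

CHEAPEST FALSIFIER. (a) Vacuity, minutes (done by the planner): BoundedCost is not vacuously false —
for A = B take p = C_ε, all m_i = 0, N = 4 (three basic pieces of degree 1 for [0,ε] and for the
graph of its indicator, ε a coefficient), uniformly in ε; one tame move between A and B likewise
gives bounded cost; and not vacuously true — bounded N forces a
uniform template, i.e. the conjecture. TameCovLimit on φ_t(x) = t·x, G' = 1, G = t: both limits are
a.e.-null representations, and the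
conclusion is SpAeCongruence-true — consistent. (b) Lookup, an hour: a printed "derivatives of
pointwise-convergent definable families
converge a.e." (Lion–Speissegger doi:10.1007/s00029-004-0360-z, van den Dries' limit sets, Coste's
notes) downgrades TameCovLimit to
difficulty M; searched lit (searchd partly down at filing) — not found verbatim. (c) One kit job
(not run: no kit in this seat): brute-force
the minimal cube mesh n₀(2^(−k)), k ≤ 10, for A = quarter disc ⊔ box vs B = region under 1/(1+x²)
(equal areas π/4): Viu-Sos packing
gives n₀ ≍ 2ᵏ; any packing family of bounded description found by SMT over piecewise-affine
volume-preserving templates would be the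
first empirical O(1) signal for an accessible transcendental pair.

NUMBERS. Viu-Sos packing cost: for K ⊆ [0,r]ᵈ with vol(N_δ(∂K)) ≤ C_K δ, the squeeze hi_n − lo_n ≤
vol(N_(√d·r/n)(∂K)) forces mesh n₀(ε) ≥ C_K √d r/ε,
i.e. ≍ (C_K √d r/ε)ᵈ cubes and a piecewise translation with that many pieces — description
complexity Θ(ε^(−d)) (boundary-only
bookkeeping: Θ(ε^(1−d))); chain LENGTH stays ≤ 8 moves for every ε (arXiv:1509.01097 §4.2).
Accessible pairs: N_c(ε) = O(1) iff a tame
bounded-complexity chain exists. Items at open: 11 (1 target, 4 cruxes, 5 support, 1 assembly).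

DEFINITION REQUESTS. D1 `KZ.TameMoveFamily` / `KZ.MoveFamilyOn` (topic
Literature/NumberTheory/Transcendental, next to KZCalculus; SHARED with route
StandardParts' request): a ℚ-semialgebraic family over T ⊆ ℝ of instances of ONE move with all data
(raw domains, integrands, Φ, a, b, F)
semialgebraic total objects over T, plus `KZ.UniformChainOn T` (finitely many move families and
signs summing to a given family of formal
combinations) and the tameness predicate — needed to state UniformFromBounded / UniformClosure
(Two-layer plan). D2 `KZ.TameCert N c ε` and
`KZ.inequalityCost c : ℚ → ℕ∞` (topic
Summits/KontsevichZagierPeriods/KontsevichZagierPeriods/Theorems or Literature addendum like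
KZDegree.lean): the inline `let`-calculus of BoundedCost as named definitions (raw real pairs, Cplx
via Basu–Pollack–Roy descriptions (≤ N basic pieces with N equations / N strict inequalities each,
real polynomials of degree ≤ N; Mathlib MvPolynomial), tame
move sets, one-sided certificates), with API: monotonicity in ε (pad by a box), cost 0-bounded for
tame-equivalent pairs, soundness
(certificate ⇒ eval c ≥ −ε); then BoundedCost, ¬BoundedCost(pair), FirstOrderLevels, PackingGrowth
are one-line statements. Cite-fact
wanted: none (Viusos2020 Thm 1.1 enters as the crux TameFormsSuffice, not as a hypothesis).

Novelty: Searches (2026-08-15): in-tree full reads of Theses/StandardParts.lean, DefinableMoves.lean,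
DimensionBudget.lean, KZCalculus(.Proofs),
KZDegree, PeriodCompactDomain, SemialgebraicVolumeComputable, the four barrier files; `ledger
negatives --problem KontsevichZagierPeriods` (0);
`lit read arxiv:1509.01097` pp. 2–3, 13–14 (Thm 1.1, §4 Lemmas 4.1–4.3, Rem. 4.1); `lit read
book:dries1998…` p. 94 (Ch. 6 (1.2) definable
choice); `lit frontier KontsevichZagierPeriods --since 2020` (30 rows: Ayoub/Kummer, odd zeta, MZV
structure, jep.335 log corners — none
on proof cost); `lit search --source crossref "periods Kontsevich Zagier conjecture"` ≥ 2010 (15: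
doi:10.1142/s179304212150007x,
doi:10.5802/jtnb.1204, doi:10.4007/annals.2015.181.3.2, doi:10.2748/tmj/1568772181); `lit search
--source crossref "definability of
Hausdorff limits o-minimal"` (8: doi:10.1007/s00029-004-0360-z, doi:10.1215/ijm/1258138029); `lit
search --hybrid "limits of semialgebraic
families change of variables …"` (12 book rows, Dries1998/Pila2022 only relevant); `lit galaxy
search --star all` ×3 ("semi-canonical
reduction…", "accessible identities between periods", "Kontsevich-Zagier conjecture": 0/0/0 rows);
zbMATH/arXiv legs returned 0, OpenAlex
rate-limited, local searchd intermittently unavailable (noted).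
Nearest prior art found: Viusos2020 (doi:10.1142/s179304212150007x = arXiv:1509.01097) §4 —
packing/difference set inside the rules for a
STRICT inequality, no cost function, no families, no limits; CressonVi  [refs: 10.1142/s179304212150007x, 10.5802/jtnb.1204, 10.4007/annals.2015.181.3.2, 10.2748/tmj/1568772181, 10.1007/s00029-004-0360-z, 10.1215/ijm/1258138029, 1509.01097, arxiv:1509.01097, book:dries1998, doi:10.1142/s179304212150007x, doi:10.5802/jtnb.1204, doi:10.4007/annals.2015.181.3.2, doi:10.2748/tmj/1568772181, doi:10.1007/s00029-004-0360-z, doi:10.1215/ijm/1258138029, Dries1998, Pila2022, Viusos202]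

Barriers (technique_class: inequality-cost, definable-choice, tame-closure): - technique_class: inequality-cost, definable-choice, tame-closure
- Literature.Barriers.KontsevichZagierPeriods.not_complete_of_undecidable: respected, not evaded —
no computable bound on N_c is claimed (that plus Conjecture 1 would decide equality of periods);
each LEVEL "size-N certificate exists at ε" is a decidable RCF condition and BoundedCost is an ∃N
statement, uncomputable in (A,B) in general; an undecidability theorem for period equality would
show N ↦ (A,B)-dependence is not computable, consistent with the route.
- Literature.Barriers.KontsevichZagierPeriods.noSemialgebraicPrimitive_inv_sub_two: not engaged — no
variable is integrated out and no primitive is invented: TameNLLimit takes limits of GIVEN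
semialgebraic primitives F_t (bounded, hence with semialgebraic limit), certificates are packings
and dissections; the barrier's scope caveat (one strategy, fixed number of variables) applies
verbatim.
- Literature.Barriers.KontsevichZagierPeriods.kzConjecture_implies_oddZetaAlgIndep: strength barrier
— carried entirely by BoundedCost (declared summit-strength) and by the target; TameCovLimit,
TameNLLimit, AddLimits, TameSqueeze, FinitePacking assert no numerical transcendence (they speak
about the calculus and limits of its instances) and TameFormsSuffice is summit-implied bookkeeping
of Viu-Sos' reduction. Not evaded for the route as a whole; the bet is that the squeeze converts the
summit for volumes into a growth statement about decidable inequality levels that Ne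

History (route lifecycle, newest last):
- 2026-08-15T16:38:24Z · rev 3: restated BoundedCost (stmt-KontsevichZagierPeriods-8988) — route-repair (cone) rev 3, unit rrepair-KontsevichZagierPeriods-Inequa-1b76663a-g2, applying the gen-1 package (evidence 20260815T1433 on the route and on stmt- (planner-rrepair-KontsevichZagierPeriods-Inequa-1b76663a-g2-0)
- 2026-08-16T02:18:25Z · AUTO-CRUX: 1 conjecture-grade item(s) promoted to crux (TameVolumeKernel) — refuter vetting / tiering apply (operator:999:1362873)
- 2026-08-17T13:41:50Z · rev 4: restated Assembly (stmt-KontsevichZagierPeriods-8996 proved) — route-repair (ground-failed, unit rground-KontsevichZagierPeriods-Inequal-1b76663a): the route's ONLY ground flag (payload.ground 2026-08-17T13:06:53Z, blocking (planner-rground-KontsevichZagierPeriods-Inequal-1b76663a-0)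
- 2026-08-24T14:38:35Z · DORMANT — reconciler: no traction for 6.8 d (last activity item-evidence-added at 2026-08-17T18:08:33Z); parked, not closed — `ledger route dormant route-KontsevichZagier (operator:999:1572644)

sub-problem: KontsevichZagierPeriods · status: dormant · opened planner-plancard-KontsevichZagierPeriods-Kont-b09e3d7d-0 2026-08-15T13:45:42Z · rev 4 · ledger route-KontsevichZagierPeriods-InequalityCost
GENERATED by the gate from the ledger (D-0016/17). Provers cite these decls: `theorem foo : Summit.KontsevichZagierPeriods.KontsevichZagierPeriods.Theses.InequalityCost.<Decl> := …` in Summits/KontsevichZagierPeriods/KontsevichZagierPeriods/Theorems/<Name>.lean.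
-/

namespace Summit.KontsevichZagierPeriods.KontsevichZagierPeriods.Theses.InequalityCost

open scoped BigOperators Topology Manifold Classical MeasureTheory ProbabilityTheory Matrix InnerProductSpace ComplexConjugate ContinuousMap
open Filter Set Function TopologicalSpace MeasureTheory

attribute [summit_statement] _root_.KontsevichZagierPeriods

open Literature Periods

/-- item stmt-KontsevichZagierPeriods-8986 · target · rank 0 · open · by planner
why it might fail: Conjecture strength: it is the summit restricted to compact volume forms (Cresson–Viu-Sos' setting), so every strength barrier applies; route Neg's suspicious pairs (triplication 0312, octic regulators) become pairs of this shape after reduction.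
sources: KontsevichZagier2001, Viusos2020, CressonViusos2022
[target] X — Conjecture 1 for tame volume forms of equal dimension: A, B : KZ.IntegralRep n with
domains in the box [−N,N]ⁿ, integrand 1 on the domain and A.value = B.value are KZ.Equivalent.
Summit-implied (volume forms are KZ-rational with p = q = 1; `example` in Sketch.lean); the squeeze
proves it from the closure lemmas and BoundedCost (TameSqueeze). -/
@[route_item "route-KontsevichZagierPeriods-InequalityCost"]
def TameVolumeKernel : Prop :=
  ∀ ⦃n : ℕ⦄ (N : ℕ) (A B : Literature.NumberTheory.Transcendental.KZ.IntegralRep n), (∀ x ∈ A.domain, ∀ i, |x i| ≤ N) → Set.EqOn A.integrand 1 A.domain → (∀ x ∈ B.domain, ∀ i, |x i| ≤ N) → Set.EqOn B.integrand 1 B.domain → A.value = B.value → Literature.NumberTheory.Transcendental.KZ.Equivalent A B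

/-- item stmt-KontsevichZagierPeriods-8987 · crux · rank 2 · open · by planner
why it might fail: Tameness bounds G, G' but not det ∂φ_t: φ_t may collapse or fold as t→0⁺, so φ_0 is no CoV instance; the proof needs (a) ∂φ_t → ∂φ_0 a.e. for tame definable families (unprinted in this form) and (b) the mass through the degenerating set to be L¹-negligible on BOTH sides.
sources: KontsevichZagier2001, Dries1998, doi:10.1007/s00029-004-0360-z, CluckersMiller2011, ComteLionRolin2000
[crux] TAME CLOSURE FOR RULE 2 (card K1, per move kind). Let S, S' ⊆ ℝⁿ⁺¹ be ℚ-semialgebraic total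
spaces (parameter t = last coordinate) with ℚ-semialgebraic integrands G on S, G' on S' and a
ℚ-semialgebraic map Φ : S → ℝⁿ, all TAME (S, S' ⊆ [−N,N]ⁿ⁺¹, |G|,|G'| ≤ N). Suppose for every t ∈
(0,1) the fibre data form a change-of-variables instance: φ_t = Φ(·,t) is injective on S_t, φ_t(S_t)
= S'_t, and at every x ∈ S_t some L with HasFDerivWithinAt φ_t L S_t x and G_t x = G'_t(φ_t x)·|det
L|. If (S_t,G_t) → r₀ and (S'_t,G'_t) → r₀' in L¹ as t → 0⁺ (r₀, r₀' : KZ.IntegralRep n), then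
KZ.Equivalent r₀ r₀'. The Jacobian is NOT assumed bounded: degeneration of φ_t in the limit is the
content. [difficulty: L] -/
@[route_item "route-KontsevichZagierPeriods-InequalityCost", crux]
def TameCovLimit : Prop :=
  ∀ ⦃n : ℕ⦄ (N : ℕ) (S S' : Set (Fin (n + 1) → ℝ)) (G G' : (Fin (n + 1) → ℝ) → ℝ) (Φ : (Fin (n + 1) → ℝ) → (Fin n → ℝ)) (r₀ r₀' : Literature.NumberTheory.Transcendental.KZ.IntegralRep n), Literature.ModelTheory.ExponentialFields.IsSemialgebraic ℚ S → Literature.NumberTheory.Transcendental.IsSemialgebraicFunOn ℚ S G → Literature.ModelTheory.ExponentialFields.IsSemialgebraic ℚ S' → Literature.NumberTheory.Transcendental.IsSemialgebraicFunOn ℚ S' G' → Literature.NumberTheory.Transcendental.IsSemialgebraicMapOn ℚ S Φ → (∀ z ∈ S, (∀ i, |z i| ≤ N) ∧ |G z| ≤ N) → (∀ z ∈ S', (∀ i, |z i| ≤ N) ∧ |G' z| ≤ N) → (∀ t ∈ Set.Ioo (0:ℝ) 1, Set.InjOn (fun x : Fin n → ℝ => Φ (Fin.snoc x t)) {x | Fin.snoc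 x t ∈ S} ∧ (fun x : Fin n → ℝ => Φ (Fin.snoc x t)) '' {x | Fin.snoc x t ∈ S} = {y | Fin.snoc y t ∈ S'} ∧ ∀ x : Fin n → ℝ, Fin.snoc x t ∈ S → ∃ L : (Fin n → ℝ) →L[ℝ] (Fin n → ℝ), HasFDerivWithinAt (fun x : Fin n → ℝ => Φ (Fin.snoc x t)) L {x | Fin.snoc x t ∈ S} x ∧ G (Fin.snoc x t) = G' (Fin.snoc (Φ (Fin.snoc x t)) t) * |L.det|) → Filter.Tendsto (fun t : ℝ => ∫ x : Fin n → ℝ, |{x : Fin n → ℝ | Fin.snoc x t ∈ S}.indicator (fun x => G (Fin.snoc x t)) x - r₀.domain.indicator r₀.integrand x|) (𝓝[>] (0:ℝ)) (𝓝 0) → Filter.Tendsto (fun t : ℝ => ∫ y : Fin n → ℝ, |{y : Fin n → ℝ | Fin.snoc y t ∈ S'}.indicator (fun y => G' (Fin.snoc y t)) y - r₀'.domain.indicator r₀'.integrand y|) (𝓝[>] (0:ℝ)) (𝓝 0) → Literature.NumberTheory.Transcendental.KZ.Equivalent r₀ r₀'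

-- earlier BoundedCost (stmt-KontsevichZagierPeriods-8988, replaced 2026-08-15T16:38:24Z -> stmt-KontsevichZagierPeriods-11056): retired by None — let X := Σ k : ℕ, Set (Fin k → ℝ) × ((Fin k → ℝ) → ℝ); let o : X → FreeAbelianGroup X := FreeAbelianGroup.of; let Cplx : ℕ → (k : ℕ) → Set (Fin k → ℝ) → Prop := fun N k S => ∃ (q : ℕ) (φ : Literature.ModelTheory.ExponentialFields.Language.orderedRing.Formu
/-- item stmt-KontsevichZagierPeriods-11056 · crux · rank 3 · open · by planner
why it might fail: Summit-strength and a little more: modulo TameSqueeze it IS Conjecture 1 for (A,B), and even when A ~ B the known chain may need untame or ε-dependent high-complexity detours (no tame conservativity theorem); for Neg's pair 0312 cost growth N_c(ε) → ∞ is precisely a disproof of Conjecture 1.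
sources: Viusos2020, arXiv:1509.01097, KontsevichZagier2001, BasuPollackRoy2006, CressonViusos2022
[crux] BOUNDED COST (card K1/K4 hypothesis, the thesis proper): for tame volume forms A, B of equal
volume there is N such that for EVERY rational ε ∈ (0,1) a one-sided ε-certificate of size ≤ N
exists: a formal identity [A]−[B]+[C_ε]−[p] = Σ_(i<N) m_i in the free abelian group on raw pairs (σ
⊆ ℝᵏ, f), where C_ε = ([0,ε] ⊆ ℝ¹, 1), p has integrand ≥ 0, and each m_i is ± an instance of one of
the four KZ moves rewritten over REAL-semialgebraic data all of which are N-TAME (k ≤ N, domains in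
[−N,N]ᵏ, |integrands| ≤ N, zero off the domain, |F| ≤ N for primitives) and of DESCRIPTION
COMPLEXITY ≤ N in the Basu–Pollack–Roy format: each set / graph is a union of ≤ N basic
semialgebraic pieces {P_i1 = … = P_iN = 0, Q_i1 > 0, …, Q_iN > 0} cut out by REAL polynomials of
total degree ≤ N (Mathlib MvPolynomial; BasuPollackRoy2006 §2.3). Rev 3 (cone repair): this replaces
rev 1's measure 'parameter-free ordered-ring formula of Gödel code ≤ N with ≤ N real parameters' —
the two ∃N-statements are equivalent (N ↦ g(N) both ways by quantifier elimination,
BasuPollackRoy2006 Thm 2.77; the real coefficients are the parameters, ε may be one of them) and the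
route no longer imports DecidableTheory. Sou -/
@[route_item "route-KontsevichZagierPeriods-InequalityCost", crux]
def BoundedCost : Prop :=
  let X := Σ k : ℕ, Set (Fin k → ℝ) × ((Fin k → ℝ) → ℝ); let o : X → FreeAbelianGroup X := FreeAbelianGroup.of; let Cplx : ℕ → (k : ℕ) → Set (Fin k → ℝ) → Prop := fun N k S => ∃ (P Q : Fin N → Fin N → MvPolynomial (Fin k) ℝ), (∀ i j, (P i j).totalDegree ≤ N ∧ (Q i j).totalDegree ≤ N) ∧ S = ⋃ i, {x | (∀ j, MvPolynomial.eval x (P i j) = 0) ∧ ∀ j, 0 < MvPolynomial.eval x (Q i j)}; let Adm : ℕ → X → Prop := fun N x => x.1 ≤ N ∧ (∀ z ∈ x.2.1, (∀ i, |z i| ≤ N) ∧ |x.2.2 z| ≤ N) ∧ (∀ z ∉ x.2.1, x.2.2 z = 0) ∧ Cplx N x.1 x.2.1 ∧ Cplx N (x.1 + 1) {w : Fin (x.1 + 1) → ℝ | Fin.init w ∈ x.2.1 ∧ w (Fin.last x.1) = x.2.2 (Fin.init w)}; let Moves : ℕ → Set (FreeAbelianGroup X) := fun N => {c | ∃ (k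 : ℕ) (σ σ₁ σ₂ : Set (Fin k → ℝ)) (f f₁ f₂ : (Fin k → ℝ) → ℝ), Adm N ⟨k, σ, f⟩ ∧ Adm N ⟨k, σ₁, f₁⟩ ∧ Adm N ⟨k, σ₂, f₂⟩ ∧ σ = σ₁ ∪ σ₂ ∧ MeasureTheory.volume (σ₁ ∩ σ₂) = 0 ∧ Set.EqOn f f₁ σ₁ ∧ Set.EqOn f f₂ σ₂ ∧ c = o ⟨k, σ, f⟩ - o ⟨k, σ₁, f₁⟩ - o ⟨k, σ₂, f₂⟩} ∪ {c | ∃ (k : ℕ) (σ : Set (Fin k → ℝ)) (f f₁ f₂ : (Fin k → ℝ) → ℝ), Adm N ⟨k, σ, f⟩ ∧ Adm N ⟨k, σ, f₁⟩ ∧ Adm N ⟨k, σ, f₂⟩ ∧ Set.EqOn f (f₁ + f₂) σ ∧ c = o ⟨k, σ, f⟩ - o ⟨k, σ, f₁⟩ - o ⟨k, σ, f₂⟩} ∪ {c | ∃ (k : ℕ) (σ σ' : Set (Fin k → ℝ)) (f f' : (Fin k → ℝ) → ℝ) (Φ : (Fin k → ℝ) → (Fin k → ℝ)) (Φ' : (Fin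 k → ℝ) → (Fin k → ℝ) →L[ℝ] (Fin k → ℝ)), Adm N ⟨k, σ, f⟩ ∧ Adm N ⟨k, σ', f'⟩ ∧ Cplx N (k + k) {w : Fin (k + k) → ℝ | (fun i : Fin k => w (Fin.castAdd k i)) ∈ σ ∧ (fun i : Fin k => w (Fin.natAdd k i)) = Φ (fun i : Fin k => w (Fin.castAdd k i))} ∧ (∀ x ∈ σ, HasFDerivWithinAt Φ (Φ' x) σ x) ∧ Set.InjOn Φ σ ∧ σ' = Φ '' σ ∧ (∀ x ∈ σ, f x = f' (Φ x) * |(Φ' x).det|) ∧ c = o ⟨k, σ, f⟩ - o ⟨k, σ', f'⟩} ∪ {c | ∃ (k : ℕ) (β : Set (Fin (k + 1) → ℝ)) (g : (Fin (k + 1) → ℝ) → ℝ) (τ : Set (Fin k → ℝ)) (h a b : (Fin k → ℝ) → ℝ) (F : (Fin (k + 1) → ℝ) → ℝ), Adm N ⟨k + 1, β, g⟩ ∧ Adm N ⟨k, τ, h⟩ ∧ Cplx N (k + 1) {w : Fin (k + 1) → ℝ | Fin.init w ∈ τ ∧ w (Fin.last k) = a (Fin.init w)} ∧ Cplx N (k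 + 1) {w : Fin (k + 1) → ℝ | Fin.init w ∈ τ ∧ w (Fin.last k) = b (Fin.init w)} ∧ Cplx N (k + 2) {w : Fin (k + 2) → ℝ | Fin.init w ∈ β ∧ w (Fin.last (k + 1)) = F (Fin.init w)} ∧ (∀ z ∈ β, |F z| ≤ N) ∧ (∀ x ∈ τ, a x ≤ b x) ∧ β = {z : Fin (k + 1) → ℝ | Fin.init z ∈ τ ∧ a (Fin.init z) ≤ z (Fin.last k) ∧ z (Fin.last k) ≤ b (Fin.init z)} ∧ (∀ x ∈ τ, ContinuousOn (fun s : ℝ => F (Fin.snoc x s)) (Set.Icc (a x) (b x))) ∧ (∀ x ∈ τ, ∀ s ∈ Set.Ioo (a x) (b x), HasDerivAt (fun s : ℝ => F (Fin.snoc x s)) (g (Fin.snoc x s)) s) ∧ (∀ x ∈ τ, h x = F (Fin.snoc x (b x)) - F (Fin.snoc x (a x))) ∧ c = o ⟨k + 1, β, g⟩ - o ⟨k, τ, h⟩}; let Cert : ℕ → (n : ℕ) → Set (Fin n → ℝ) → Set (Fin n → ℝ) → ℝ → Prop := fun N n σA σB ε => ∃ (kp : ℕ) (π : Set (Fin kp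 → ℝ)) (gp : (Fin kp → ℝ) → ℝ) (m : Fin N → FreeAbelianGroup X), Adm N ⟨kp, π, gp⟩ ∧ (∀ z ∈ π, 0 ≤ gp z) ∧ (∀ i, m i ∈ Moves N ∨ -m i ∈ Moves N ∨ m i = 0) ∧ o ⟨n, σA, σA.indicator (fun _ => (1:ℝ))⟩ - o ⟨n, σB, σB.indicator (fun _ => (1:ℝ))⟩ + o ⟨1, {x : Fin 1 → ℝ | 0 ≤ x 0 ∧ x 0 ≤ ε}, {x : Fin 1 → ℝ | 0 ≤ x 0 ∧ x 0 ≤ ε}.indicator (fun _ => (1:ℝ))⟩ - o ⟨kp, π, gp⟩ = ∑ i, m i; ∀ ⦃n : ℕ⦄ (N₀ : ℕ) (A B : Literature.NumberTheory.Transcendental.KZ.IntegralRep n), (∀ x ∈ A.domain, ∀ i, |x i| ≤ N₀) → Set.EqOn A.integrand 1 A.domain → (∀ x ∈ B.domain, ∀ i, |x i| ≤ N₀) → Set.EqOn B.integrand 1 B.domain → A.value = B.value → ∃ N : ℕ, ∀ ε : ℚ, 0 < ε → ε < 1 → Cert N n A.domain B.domain ε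

/-- item stmt-KontsevichZagierPeriods-8989 · crux · rank 4 · open · by planner
why it might fail: G_0(x,·) is only piecewise continuous and a_0 = b_0 may hold on fat parts of T_0, so rule 3 fails for the raw limit band: it must be re-split along the semialgebraic discontinuity locus and null bands discarded; F_t → F_0 needs |F| ≤ N (renormalised primitives).
sources: KontsevichZagier2001, Dries1998, ComteLionRolin2000, BochnakCosteRoy1998
[crux] TAME CLOSURE FOR RULE 3. Let B ⊆ ℝⁿ⁺² (band points (x,s,t), t = last coordinate the
parameter, s the integration variable) and T ⊆ ℝⁿ⁺¹ (base points (x,t)) be ℚ-semialgebraic, with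
ℚ-semialgebraic G, F on B and H, a, b on T, all tame (boxes [−N,N], |G|,|F|,|H| ≤ N). Suppose for
every t ∈ (0,1): a_t ≤ b_t on T_t, B_t is the band {(x,s) : x ∈ T_t, a_t x ≤ s ≤ b_t x}, s ↦
F_t(x,s) is continuous on [a_t x, b_t x] with derivative G_t(x,s) on the open fibre, and H_t x =
F_t(x,b_t x) − F_t(x,a_t x). If (B_t,G_t) → r₀ (dimension n+1) and (T_t,H_t) → r₀' (dimension n) in
L¹ as t → 0⁺ then KZ.Equivalent r₀ r₀'. [difficulty: L] -/
@[route_item "route-KontsevichZagierPeriods-InequalityCost", crux]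
def TameNLLimit : Prop :=
  ∀ ⦃n : ℕ⦄ (N : ℕ) (B : Set (Fin (n + 2) → ℝ)) (T : Set (Fin (n + 1) → ℝ)) (G F : (Fin (n + 2) → ℝ) → ℝ) (H a b : (Fin (n + 1) → ℝ) → ℝ) (r₀ : Literature.NumberTheory.Transcendental.KZ.IntegralRep (n + 1)) (r₀' : Literature.NumberTheory.Transcendental.KZ.IntegralRep n), Literature.ModelTheory.ExponentialFields.IsSemialgebraic ℚ B → Literature.ModelTheory.ExponentialFields.IsSemialgebraic ℚ T → Literature.NumberTheory.Transcendental.IsSemialgebraicFunOn ℚ B G → Literature.NumberTheory.Transcendental.IsSemialgebraicFunOn ℚ B F → Literature.NumberTheory.Transcendental.IsSemialgebraicFunOn ℚ T H → Literature.NumberTheory.Transcendental.IsSemialgebraicFunOn ℚ T a → Literature.NumberTheory.Transcendental.IsSemialgebraicFunOn ℚ T b → (∀ z ∈ B, (∀ i, |z i| ≤ N) ∧ |G z| ≤ N ∧ |F z| ≤ N) → (∀ z ∈ T, (∀ i, |z i| ≤ N) ∧ |H z| ≤ N) → (∀ t ∈ Set.Ioo (0:ℝ) 1, (∀ x : Fin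 n → ℝ, Fin.snoc x t ∈ T → a (Fin.snoc x t) ≤ b (Fin.snoc x t)) ∧ {w : Fin (n + 1) → ℝ | Fin.snoc w t ∈ B} = {w : Fin (n + 1) → ℝ | Fin.snoc (Fin.init w) t ∈ T ∧ a (Fin.snoc (Fin.init w) t) ≤ w (Fin.last n) ∧ w (Fin.last n) ≤ b (Fin.snoc (Fin.init w) t)} ∧ (∀ x : Fin n → ℝ, Fin.snoc x t ∈ T → ContinuousOn (fun s : ℝ => F (Fin.snoc (Fin.snoc x s) t)) (Set.Icc (a (Fin.snoc x t)) (b (Fin.snoc x t)))) ∧ (∀ x : Fin n → ℝ, Fin.snoc x t ∈ T → ∀ s ∈ Set.Ioo (a (Fin.snoc x t)) (b (Fin.snoc x t)), HasDerivAt (fun s : ℝ => F (Fin.snoc (Fin.snoc x s) t)) (G (Fin.snoc (Fin.snoc x s) t)) s) ∧ (∀ x : Fin n → ℝ, Fin.snoc x t ∈ T → H (Fin.snoc x t) = F (Fin.snoc (Fin.snoc x (b (Fin.snoc x t))) t) - F (Fin.snoc (Fin.snoc x (a (Fin.snoc x t))) t))) → Filter.Tendsto (fun t : ℝ => ∫ w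 : Fin (n + 1) → ℝ, |{w : Fin (n + 1) → ℝ | Fin.snoc w t ∈ B}.indicator (fun w => G (Fin.snoc w t)) w - r₀.domain.indicator r₀.integrand w|) (𝓝[>] (0:ℝ)) (𝓝 0) → Filter.Tendsto (fun t : ℝ => ∫ x : Fin n → ℝ, |{x : Fin n → ℝ | Fin.snoc x t ∈ T}.indicator (fun x => H (Fin.snoc x t)) x - r₀'.domain.indicator r₀'.integrand x|) (𝓝[>] (0:ℝ)) (𝓝 0) → Literature.NumberTheory.Transcendental.KZ.Equivalent r₀ r₀'

/-- item stmt-KontsevichZagierPeriods-8990 · crux · rank 5 · open · by planner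
why it might fail: Viu-Sos asserts "respects the KZ-rules" only informally (Rem. 4.1, §2.3): resolution must keep every intermediate piece absolutely convergent and ℚ-semialgebraic, and blow-up charts are CoV instances only off exceptional divisors; Hironaka in Lean is XL.
sources: Viusos2020, Hironaka1964, BelkaleBrosnan2003, Yoshinaga2008, KontsevichZagier2001
[crux] TAME VOLUME FORMS SUFFICE: TameVolumeKernel → KontsevichZagierPeriods. Plan (Viusos2020 Thm
1.1 / Cor. 2.3 "respecting the KZ-rules"): every KZ-rational representation is KZ-equivalent to [K₁]
− [K₂] with K₁, K₂ compact top-dimensional ℚ-semialgebraic sets carrying integrand 1 — compactify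
the domain by the projective cube charts (tree: PeriodCompactDomain, CoV moves), separate the
boundary poles by embedded resolution of ∂S ∪ {PQ = 0} (blow-ups are CoV moves off exceptional
divisors; Hironaka1964, BelkaleBrosnan2003), pass to volume form by the graph trick (tree:
KZ.IntegralRep.graphRep, one Newton–Leibniz move), pad dimensions (tree: exists_equivalent_of_le)
and glue disjoint translates (tree: IntegralRep.glue); then r ~ [A]−[B], r' ~ [A']−[B'] with vol(A ⊔
B') = vol(B ⊔ A') and TameVolumeKernel closes the chain. [difficulty: XL] -/
@[route_item "route-KontsevichZagierPeriods-InequalityCost", crux]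
def TameFormsSuffice : Prop :=
  TameVolumeKernel → KontsevichZagierPeriods

/-- item stmt-KontsevichZagierPeriods-8991 · support · rank 9 · open · by planner
sources: KontsevichZagier2001, BochnakCosteRoy1998
[support] TAME CLOSURE FOR RULE 1 (both halves): L¹-limits at 0⁺ of tame ℚ-semialgebraic families of
domain-additivity instances (S_t = S₁_t ∪ S₂_t with null overlap, integrands agreeing) resp.
integrand-additivity instances (G = G₁ + G₂ on S) satisfy [r] − [r₁] − [r₂] ∈ KZ.relations. Proof:
the a.e. identity 1_r f = 1_(r₁) f₁ + 1_(r₂) f₂ passes to L¹-limits; split ℝⁿ along the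
ℚ-semialgebraic Boolean atoms of the three domains and of {f = f₁ + f₂}, {f = f₁}, {f = f₂}
(Tarski–Seidenberg, tree tarski_seidenberg_real_holds), use integrand additivity on fat overlaps and
domain additivity elsewhere, and kill null discrepancies as in StandardParts' SpAeCongruence
(stmt-3156). [difficulty: provable-now] -/
@[route_item "route-KontsevichZagierPeriods-InequalityCost", crux]
def AddLimits : Prop :=
  (∀ ⦃n : ℕ⦄ (N : ℕ) (S S₁ S₂ : Set (Fin (n + 1) → ℝ)) (G G₁ G₂ : (Fin (n + 1) → ℝ) → ℝ) (r r₁ r₂ : Literature.NumberTheory.Transcendental.KZ.IntegralRep n), Literature.ModelTheory.ExponentialFields.IsSemialgebraic ℚ S → Literature.ModelTheory.ExponentialFields.IsSemialgebraic ℚ S₁ → Literature.ModelTheory.ExponentialFields.IsSemialgebraic ℚ S₂ → Literature.NumberTheory.Transcendental.IsSemialgebraicFunOn ℚ S G → Literature.NumberTheory.Transcendental.IsSemialgebraicFunOn ℚ S₁ G₁ → Literature.NumberTheory.Transcendental.IsSemialgebraicFunOn ℚ S₂ G₂ → (∀ z ∈ S ∪ S₁ ∪ S₂, ∀ i, |z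 i| ≤ N) → (∀ z ∈ S, |G z| ≤ N) → (∀ z ∈ S₁, |G₁ z| ≤ N) → (∀ z ∈ S₂, |G₂ z| ≤ N) → (∀ t ∈ Set.Ioo (0:ℝ) 1, {x : Fin n → ℝ | Fin.snoc x t ∈ S} = {x | Fin.snoc x t ∈ S₁} ∪ {x | Fin.snoc x t ∈ S₂} ∧ MeasureTheory.volume ({x : Fin n → ℝ | Fin.snoc x t ∈ S₁} ∩ {x | Fin.snoc x t ∈ S₂}) = 0 ∧ (∀ x : Fin n → ℝ, Fin.snoc x t ∈ S₁ → G (Fin.snoc x t) = G₁ (Fin.snoc x t)) ∧ (∀ x : Fin n → ℝ, Fin.snoc x t ∈ S₂ → G (Fin.snoc x t) = G₂ (Fin.snoc x t))) → Filter.Tendsto (fun t : ℝ => ∫ x : Fin n → ℝ, |{x : Fin n → ℝ | Fin.snoc x t ∈ S}.indicator (fun x => G (Fin.snoc x t)) x - r.domain.indicator r.integrand x|) (𝓝[>] (0:ℝ)) (𝓝 0) → Filter.Tendsto (fun t : ℝ => ∫ x : Fin n → ℝ, |{x : Fin n → ℝ | Fin.snoc x t ∈ S₁}.indicator (fun x =>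 G₁ (Fin.snoc x t)) x - r₁.domain.indicator r₁.integrand x|) (𝓝[>] (0:ℝ)) (𝓝 0) → Filter.Tendsto (fun t : ℝ => ∫ x : Fin n → ℝ, |{x : Fin n → ℝ | Fin.snoc x t ∈ S₂}.indicator (fun x => G₂ (Fin.snoc x t)) x - r₂.domain.indicator r₂.integrand x|) (𝓝[>] (0:ℝ)) (𝓝 0) → Literature.NumberTheory.Transcendental.KZ.of r - Literature.NumberTheory.Transcendental.KZ.of r₁ - Literature.NumberTheory.Transcendental.KZ.of r₂ ∈ Literature.NumberTheory.Transcendental.KZ.relations) ∧ (∀ ⦃n : ℕ⦄ (N : ℕ) (S : Set (Fin (n + 1) → ℝ)) (G G₁ G₂ : (Fin (n + 1) → ℝ) → ℝ) (r r₁ r₂ : Literature.NumberTheory.Transcendental.KZ.IntegralRep n), Literature.ModelTheory.ExponentialFields.IsSemialgebraic ℚ S → Literature.NumberTheory.Transcendental.IsSemialgebraicFunOn ℚ S G → Literature.NumberTheory.Transcendental.IsSemialgebraicFunOn ℚ S G₁ → Literature.NumberTheory.Transcendental.IsSemialgebraicFunOn ℚ S G₂ → (∀ z ∈ S, (∀ i,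 |z i| ≤ N) ∧ |G z| ≤ N ∧ |G₁ z| ≤ N ∧ |G₂ z| ≤ N) → (∀ z ∈ S, G z = G₁ z + G₂ z) → Filter.Tendsto (fun t : ℝ => ∫ x : Fin n → ℝ, |{x : Fin n → ℝ | Fin.snoc x t ∈ S}.indicator (fun x => G (Fin.snoc x t)) x - r.domain.indicator r.integrand x|) (𝓝[>] (0:ℝ)) (𝓝 0) → Filter.Tendsto (fun t : ℝ => ∫ x : Fin n → ℝ, |{x : Fin n → ℝ | Fin.snoc x t ∈ S}.indicator (fun x => G₁ (Fin.snoc x t)) x - r₁.domain.indicator r₁.integrand x|) (𝓝[>] (0:ℝ)) (𝓝 0) → Filter.Tendsto (fun t : ℝ => ∫ x : Fin n → ℝ, |{x : Fin n → ℝ | Fin.snoc x t ∈ S}.indicator (fun x => G₂ (Fin.snoc x t)) x - r₂.domain.indicator r₂.integrand x|) (𝓝[>] (0:ℝ)) (𝓝 0) → Literature.NumberTheory.Transcendental.KZ.of r - Literature.NumberTheory.Transcendental.KZ.of r₁ - Literature.NumberTheory.Transcendental.KZ.of r₂ ∈ Literature.NumberTheory.Transcendental.KZ.relations)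

/-- item stmt-KontsevichZagierPeriods-8992 · support · rank 9 · open · by planner
sources: Dries1998, doi:10.1007/s00029-004-0360-z, LionRolin1998, Tarski1951
[support] every tame ℚ-semialgebraic family (S ⊆ [−N,N]ⁿ⁺¹, |G| ≤ N on S) has an L¹-limit
representation r₀ : KZ.IntegralRep n as t → 0⁺: pointwise limits of t ↦ 1_(S_t)(x) G(x,t) exist by
o-minimal monotonicity (tree: real_isOMinimal_holds, OMinimalLimits.tendsto_nhdsGT_or), the limit
set/function are ∅-definable hence ℚ-semialgebraic (definable_iff_isSemialgebraic_real_holds),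
bounded, and dominated convergence gives L¹-convergence. Supplies the limit objects of every
intermediate family in TameSqueeze. [difficulty: provable-now] -/
@[route_item "route-KontsevichZagierPeriods-InequalityCost"]
def TameLimitExists : Prop :=
  ∀ ⦃n : ℕ⦄ (N : ℕ) (S : Set (Fin (n + 1) → ℝ)) (G : (Fin (n + 1) → ℝ) → ℝ), Literature.ModelTheory.ExponentialFields.IsSemialgebraic ℚ S → Literature.NumberTheory.Transcendental.IsSemialgebraicFunOn ℚ S G → (∀ z ∈ S, (∀ i, |z i| ≤ N) ∧ |G z| ≤ N) → ∃ r₀ : Literature.NumberTheory.Transcendental.KZ.IntegralRep n, Filter.Tendsto (fun t : ℝ => ∫ x : Fin n → ℝ, |{x : Fin n → ℝ | Fin.snoc x t ∈ S}.indicator (fun x => G (Fin.snoc x t)) x - r₀.domain.indicator r₀.integrand x|) (𝓝[>] (0:ℝ)) (𝓝 0)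

/-- item stmt-KontsevichZagierPeriods-8993 · support · rank 9 · open · by planner
sources: Dries1998, BochnakCosteRoy1998, BasuPollackRoy2006
[support] DEFINABLE CHOICE over ℚ (semialgebraic selection): a ℚ-semialgebraic V ⊆ ℝᵖ⁺ᵠ admits a
ℚ-semialgebraic section g over its projection (Dries1998 Ch. 6 (1.2), p. 94: e(X) built from least
elements, ±1 and midpoints, hence ∅-definable; with definable_iff_isSemialgebraic_real_holds).
Shared need of StandardParts (SpDefinableChoice) and DefinableMoves (AlgebraicPoints is its p = 0
shadow). [difficulty: provable-now] -/
@[route_item "route-KontsevichZagierPeriods-InequalityCost"]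
def DefinableChoice : Prop :=
  ∀ ⦃p q : ℕ⦄ (V : Set (Fin (p + q) → ℝ)), Literature.ModelTheory.ExponentialFields.IsSemialgebraic ℚ V → ∃ g : (Fin p → ℝ) → (Fin q → ℝ), Literature.NumberTheory.Transcendental.IsSemialgebraicMapOn ℚ {x | ∃ y, Fin.append x y ∈ V} g ∧ ∀ (x : Fin p → ℝ) (y : Fin q → ℝ), Fin.append x y ∈ V → Fin.append x (g x) ∈ V

/-- item stmt-KontsevichZagierPeriods-8994 · support · rank 9 · open · by planner
sources: Viusos2020, arXiv:1509.01097, Yoshinaga2008, KontsevichZagier2001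
[support] FINITE COST AT EVERY LEVEL (card K3 qualitative; Viu-Sos §4 inside the TAME rules): for
tame volume forms A, B ⊆ ℝⁿ⁺¹ of equal volume and every rational ε > 0 there are M, the box K =
[0,ε]×[0,1]ⁿ with integrand 1 and a tame P with 0 ≤ integrand ≤ M such that [A] + [K] − [B] − [P]
lies in the subgroup generated by move instances all of whose representations are M-tame (dimension
≤ M, domain in [−M,M], |integrand| ≤ M on the domain) — the DimensionBudget-style intersection of
the move sets with the tame sub-free-group. Proof: glue translates (CoV by translation), dyadic mesh
with innerCount(A ⊔ K) ≥ outerCount(B) for fine mesh (tree: SemialgVolume.lo_le / le_hi /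
exists_hi_sub_lo_le, volume_frontier_eq_zero; Viusos2020 Lemmas 4.1–4.3 need vol(A ⊔ K) > vol B,
true as ε > 0), one piecewise-translation CoV on the open cubes, domain additivity, null wire-net
killed by [N]−[N]−[N] ∈ domainAddRel. Certifies N_c(ε) < ∞ and validates the certificate format of
BoundedCost. [difficulty: L] -/
@[route_item "route-KontsevichZagierPeriods-InequalityCost"]
def FinitePacking : Prop :=
  ∀ ⦃n : ℕ⦄ (N : ℕ) (A B : Literature.NumberTheory.Transcendental.KZ.IntegralRep (n + 1)), (∀ x ∈ A.domain, ∀ i, |x i| ≤ N) → Set.EqOn A.integrand 1 A.domain → (∀ x ∈ B.domain, ∀ i, |x i| ≤ N) → Set.EqOn B.integrand 1 B.domain → A.value = B.value → ∀ ε : ℚ, 0 < ε → ∃ (M : ℕ) (K P : Literature.NumberTheory.Transcendental.KZ.IntegralRep (n + 1)), K.domain = {x | (0 ≤ x 0 ∧ x 0 ≤ (ε : ℝ)) ∧ ∀ i, i ≠ 0 → 0 ≤ x i ∧ x i ≤ 1} ∧ Set.EqOn K.integrand 1 K.domain ∧ (∀ x ∈ P.domain, ∀ i, |x i| ≤ M)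 ∧ (∀ x ∈ P.domain, 0 ≤ P.integrand x ∧ P.integrand x ≤ M) ∧ Literature.NumberTheory.Transcendental.KZ.of A + Literature.NumberTheory.Transcendental.KZ.of K - Literature.NumberTheory.Transcendental.KZ.of B - Literature.NumberTheory.Transcendental.KZ.of P ∈ AddSubgroup.closure ((Literature.NumberTheory.Transcendental.KZ.domainAddRel ∪ Literature.NumberTheory.Transcendental.KZ.integrandAddRel ∪ Literature.NumberTheory.Transcendental.KZ.changeOfVariablesRel ∪ Literature.NumberTheory.Transcendental.KZ.newtonLeibnizRel) ∩ (AddSubgroup.closure {c : Literature.NumberTheory.Transcendental.KZ.FormalRep | ∃ (k : ℕ) (s : Literature.NumberTheory.Transcendental.KZ.IntegralRep k), k ≤ M ∧ (∀ y ∈ s.domain, ∀ i, |y i| ≤ M) ∧ (∀ y ∈ s.domain, |s.integrand y| ≤ M) ∧ c = Literature.NumberTheory.Transcendental.KZ.of s} : Set Literature.NumberTheory.Transcendental.KZ.FormalRep))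

/-- item stmt-KontsevichZagierPeriods-8995 · support · rank 9 · open · by planner
sources: Tarski1951, Dries1998, BasuPollackRoy2006, Viusos2020, KontsevichZagier2001
[support] THE SQUEEZE (card K1 + K2 + P2, the glue; provable now modulo its four hypotheses):
AddLimits → TameCovLimit → TameNLLimit → BoundedCost → TameVolumeKernel. Proof: (i) FirstOrderLevels
— for fixed A, B, N the set L_N = {ε ∈ (0,1) | a size-N certificate exists} is a finite union over
the finitely many discrete templates (dimensions, formula codes ≤ N, move kinds, signs,
generator-coincidence pattern) of projections of ∅-definable sets: every side condition is
first-order for definable data (set identities, EqOn, InjOn, image, ε-δ HasFDerivWithinAt with an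
existential matrix, ContinuousOn, HasDerivAt, a ≤ b; volume-zero ⟺ empty interior, DefinableMoves
NullIffEmptyInterior; integrability is absent because tame data are bounded Borel on bounded sets),
so L_N is ℚ-semialgebraic (tarski_seidenberg_real_holds, definable_iff_isSemialgebraic_real_holds);
(ii) L_N ⊇ ℚ∩(0,1) ⇒ cofinite ⇒ ⊇ (0,δ), and by o-minimality ONE template covers some (0,δ'), δ' ∈
ℚ; (iii) DefinableChoice gives ∅-definable parameters θ(t), t ∈ (0,δ'), i.e. ℚ-semialgebraic tame
total families for every datum; rescale t ↦ δ't; (iv) TameLimitExists gives limit representations of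
all intermediate families, the co -/
@[route_item "route-KontsevichZagierPeriods-InequalityCost", crux]
def TameSqueeze : Prop :=
  AddLimits → TameCovLimit → TameNLLimit → BoundedCost → TameVolumeKernel

-- earlier Assembly (stmt-KontsevichZagierPeriods-8996, replaced 2026-08-17T13:41:50Z -> stmt-KontsevichZagierPeriods-18205): proved by Summit.KontsevichZagierPeriods.InequalityCost.assembly_proof @ 7343233001e8 — TameSqueeze → AddLimits → TameCovLimit → TameNLLimit → BoundedCost → TameFormsSuffice → KontsevichZagierPeriods
/-- item stmt-KontsevichZagierPeriods-18205 · assembly · rank 1 · open · by planner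
sources: KontsevichZagier2001, Viusos2020
[assembly] FRAME STATEMENT — the four ranked cruxes imply the summit: TameCovLimit → BoundedCost →
TameNLLimit → TameFormsSuffice → KontsevichZagierPeriods (rank order 2, 3, 4, 5). Content = the two
rank-9 supports on the path of `closes`, AddLimits (tame closure for rule 1, provable-now) and
TameSqueeze (the squeeze, L), USED INSIDE THE PROOF instead of assumed: `fun hC hB hN hF => hF
(tameSqueeze_proof addLimits_proof hC hN hB)` closes it the moment both land (planner Sketch.lean,
lean check rc 0: `example (hS : TameSqueeze) (hA : AddLimits) : Assembly := fun hC hB hN hF => hF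
(hS hA hC hN hB)`; conversely the rev-3 chain follows from it by `fun _ _ hC hN hB hF => h hC hB hN
hF`). RESTATED 2026-08-17 by the route-repair seat (ground-failed): the rev-3 form `TameSqueeze →
AddLimits → TameCovLimit → TameNLLimit → BoundedCost → TameFormsSuffice → KontsevichZagierPeriods`
(stmt-KontsevichZagierPeriods-8996, proved by Theorems/InequalityCostAssembly.lean as the term
`closes`) was binder-for-binder the type of the deciding theorem and, TameSqueeze / TameFormsSuffice
being arrow-shaped items, was closed by the gate battery's `intros; aesop` (ground.trivial — the
route's only ground flag -/
@[route_item "route-KontsevichZagierPeriods-InequalityCost"]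
def Assembly : Prop :=
  TameCovLimit → BoundedCost → TameNLLimit → TameFormsSuffice → KontsevichZagierPeriods

/-! D-0027 §2.1 — DECIDING THEOREM (planner-authored via `route open/edit --closes-file`; by planner-rrepair-KontsevichZagierPeriods-Inequa-1b76663a-g2-0 2026-08-15T16:38:24Z):
its hypotheses are this route's items and its conclusion the sub-problem Statement (glue_lint), and it elaborates with this file. -/

/-- Route glue (D-0027 §2.1), pure logic: the squeeze `TameSqueeze` turns the tame closure lemmas for
rules 1–3 (`AddLimits`, `TameCovLimit`, `TameNLLimit`) and the bounded-cost thesis `BoundedCost` into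
Conjecture 1 for tame volume forms (`TameVolumeKernel`), and `TameFormsSuffice` (compactification +
resolution respecting the KZ rules) reduces the summit statement to that kernel. -/
@[closes "route-KontsevichZagierPeriods-InequalityCost"] theorem closes (hS : TameSqueeze) (hA : AddLimits) (hC : TameCovLimit) (hN : TameNLLimit)
    (hB : BoundedCost) (hF : TameFormsSuffice) : KontsevichZagierPeriods :=
  hF (hS hA hC hN hB)

end Summit.KontsevichZagierPeriods.KontsevichZagierPeriods.Theses.InequalityCost
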